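import Literature.MathematicalPhysics.QuantumFieldTheory.Balaban1983to89.T4AveragingDeficitWallBoundary
import HarnessLib

/-!
# T⁴ programme, node NE3 — census R37 (file 1∕3): THE BARRIER COMPARISON BEHIND THE LATTICE INTERIOR GRADIENT ESTIMATE
# (Gilbarg–Trudinger Thm 3.9 on `ℤᵈ`: odd reflection about a HALF-INTEGER hyperplane, a quadratic barrier, the strict maximum principle)

Cell `pub-balaban-gaps` (YM blitz, track G2, seat `ne3`, unit `pub-balaban-gaps-ne3-g8`; writer prover-pub-balaban-gaps-ne3-g8-0, 2026-08-24), census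
`run/shared/lean/pub/pub-balaban-gaps/ne/NE3.md` §4 R37, §14.  WHY.  Gen 7 reduced the END's sup letter `hK` at the flat datum to two sup-norm facts
(`Spine/NE3/LandauCorrectionSupB8Flat`): (H0) — for `u ∈ N(Q′(1))` (skew, periodic, nested block means zero) `‖u‖_∞ ≤ c₀M²‖Δ_1u‖_∞` and
`‖D_1u‖_∞ ≤ c₁M‖Δ_1u‖_∞`, `M = L^{j+1}` — and (HR); and recorded (H0) as «[3]-type, NOT elementary in d = 4» (the energy∕Fourier route loses
`(log M)^{1∕2}`).  The MAXIMUM PRINCIPLE gives it elementarily, uniformly in `M` and in the volume; this file is its analytic core: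

**`sub_le_of_laplacian_aux`** — for `u : ℤᵈ → ℝ`, a direction `μ`, an integer radius `R ≥ 1`, bounds `|u| ≤ U` and
`|Σ_i ((u(x+e_i) − u x) − (u x − u(x−e_i)))| ≤ B` on the sup-cube `{|x_i| ≤ R}`, and any `B′ > B`: `u(e_μ) − u(0) ≤ 2·(d·U∕R + R·B′)`.
MECHANISM: the odd reflection `φ(x) = ½(u x − u(ρx))`, `ρ` = reflection of the `μ`-coordinate about the HALF-integer `½` (so `φ(e_μ) = ½(u(e_μ) − u 0)`,
`φ(ρp) = −φ(p)`), is compared on the finite half-cube `Ω = {|x_i| ≤ R, 1 ≤ x_μ ≤ R}` with the quadratic barrier `ψ(x) = c·Σ_i x_i² + kR·x_μ − k·x_μ²`,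
`c = U∕R²`, `k = d·c + B′`: `ψ ≥ U ≥ φ` on the top layer `x_μ = R` and on the side faces `|x_i| = R`, the lattice Laplacian of `ψ` is the constant `−2B′`,
and at an ARGMAX `p` of `φ − ψ` over `Ω` with `φ p > ψ p` the lattice Laplacian of `φ` is `≥ −B` (Poisson at `p` and at `ρp`) but `< −B` (maximality over the
neighbours in `Ω`; on the first layer `x_μ = 1` the missing neighbour `p − e_μ = ρp` is served by oddness and by `ψ(p − e_μ) + ψ(p) ≥ 0`) — contradiction.
Reflecting about `½` rather than about a lattice hyperplane is what bounds the FORWARD difference `u(e_μ) − u(0)` (not the centred one); strictness comes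
from `B′ > B` and `φ p > ψ p`, so no connectivity argument is needed.  Files 2∕3 (`NE3DiscreteGradientEstimate`: the estimate in a real normed space and the
block-mean bootstrap) and 3∕3 (`Spine/NE3/LandauCorrectionSupB8FlatH0`: (H0) at the flat datum for every `(L, N, j)`, the unconditional flat `hK` on the unit
torus) consume it.

CONTENT ([folklore] lattice potential theory; 0 sorry; no `def`): §0 sums of squares on the lattice; §1 the comparison.
HONEST FRAMING.  Elementary lattice analysis; nothing about Bałaban's minimisers or curved backgrounds; (HR), `hK` over `sfClass`, (P♮) at curved `W`, the
covariant root and **NE3 are NOT proved**; spine PROVED 0∕9; finite T⁴ rung (B)+1 — NOT continuum YM on ℝ⁴, NOT infinite volume, NOT mass gap, NOT Clay.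
PLACEMENT: `Summits/QuantumFields/BalabanUV/T4Continuum/Support/`.
-/

set_option autoImplicit false

open scoped BigOperators
open Finset

namespace Summit.QuantumFields.BalabanUV.T4Continuum.NE3LatticeGradientBarrier

open Literature.MathematicalPhysics.QuantumFieldTheory.Balaban1983to89
open B7Prop1Explicit

noncomputable section

variable {d : ℕ}


/-! ## §0 Lattice bookkeeping: the unit vectors, the sup-cube, sums of squares -/

/-- `Σ_i (x + e_j)_i² = Σ_i x_i² + 2x_j + 1` (over `ℝ`). [folklore] -/
theorem sum_sq_add_e (x : Site d) (j : Fin d) :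
    ∑ i, (((x + e j) i : ℤ) : ℝ) ^ 2 = ∑ i, ((x i : ℤ) : ℝ) ^ 2 + 2 * ((x j : ℤ) : ℝ) + 1 := by
  have h : ∀ i, (((x + e j) i : ℤ) : ℝ) ^ 2 = ((x i : ℤ) : ℝ) ^ 2 + (if i = j then 2 * ((x i : ℤ) : ℝ) + 1 else 0) := by
    intro i
    rw [Pi.add_apply, e_apply]
    split_ifs <;> push_cast <;> ring
  simp only [h, Finset.sum_add_distrib, Finset.sum_ite_eq', Finset.mem_univ, if_true]
  ring

/-- `Σ_i (x − e_j)_i² = Σ_i x_i² − 2x_j + 1` (over `ℝ`). [folklore] -/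
theorem sum_sq_sub_e (x : Site d) (j : Fin d) :
    ∑ i, (((x - e j) i : ℤ) : ℝ) ^ 2 = ∑ i, ((x i : ℤ) : ℝ) ^ 2 - 2 * ((x j : ℤ) : ℝ) + 1 := by
  have h : ∀ i, (((x - e j) i : ℤ) : ℝ) ^ 2 = ((x i : ℤ) : ℝ) ^ 2 + (if i = j then -2 * ((x i : ℤ) : ℝ) + 1 else 0) := by
    intro i
    rw [Pi.sub_apply, e_apply]
    split_ifs <;> push_cast <;> ring
  simp only [h, Finset.sum_add_distrib, Finset.sum_ite_eq', Finset.mem_univ, if_true]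
  ring

/-- One square is below the sum of squares. [folklore] -/
theorem sq_le_sum_sq (x : Site d) (j : Fin d) : ((x j : ℤ) : ℝ) ^ 2 ≤ ∑ i, ((x i : ℤ) : ℝ) ^ 2 :=
  Finset.single_le_sum (f := fun i => ((x i : ℤ) : ℝ) ^ 2) (fun _ _ => sq_nonneg _) (Finset.mem_univ j)

/-- Two distinct squares are below the sum of squares. [folklore] -/
theorem sq_add_sq_le_sum_sq (x : Site d) {i j : Fin d} (hij : i ≠ j) :
    ((x i : ℤ) : ℝ) ^ 2 + ((x j : ℤ) : ℝ) ^ 2 ≤ ∑ l, ((x l : ℤ) : ℝ) ^ 2 := by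
  classical
  have h := Finset.sum_le_sum_of_subset_of_nonneg (f := fun l => ((x l : ℤ) : ℝ) ^ 2) (Finset.subset_univ ({i, j} : Finset (Fin d)))
    (fun l _ _ => sq_nonneg _)
  rwa [Finset.sum_pair hij] at h

/-! ## §1 The scalar interior gradient estimate (lattice Gilbarg–Trudinger 3.9) -/

/-- **THE BARRIER COMPARISON AT THE ORIGIN, STRICT FORM**: for `u : ℤᵈ → ℝ`, `R ≥ 1`, `|u| ≤ U` and `|Δu| ≤ B` on the sup-cube of radius `R` about `0`,
and any `B′ > B`: `u(e_μ) − u(0) ≤ 2·(d·U∕R + R·B′)`.  Proof: odd reflection about `x_μ = ½`, quadratic barrier, argmax over the finite half-cube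
(module docstring). [folklore] -/
theorem sub_le_of_laplacian_aux (μ : Fin d) {R : ℕ} (hR : 1 ≤ R) (u : Site d → ℝ) {U B B' : ℝ} (hBB' : B < B')
    (hU : ∀ x : Site d, (∀ i, |x i| ≤ (R : ℤ)) → |u x| ≤ U)
    (hB : ∀ x : Site d, (∀ i, |x i| ≤ (R : ℤ)) → |∑ i, ((u (x + e i) - u x) - (u x - u (x - e i)))| ≤ B) :
    u (e μ) - u 0 ≤ 2 * ((d : ℝ) * U / R + R * B') := by
  classical
  -- signs and constants
  have h0cube : ∀ i, |(0 : Site d) i| ≤ (R : ℤ) := fun i => by simp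
  have hU0 : 0 ≤ U := (abs_nonneg _).trans (hU 0 h0cube)
  have hB0 : 0 ≤ B := (abs_nonneg _).trans (hB 0 h0cube)
  have hB'0 : 0 < B' := lt_of_le_of_lt hB0 hBB'
  have hR0 : (0 : ℝ) < R := by exact_mod_cast hR
  have hR1 : (1 : ℝ) ≤ R := by exact_mod_cast hR
  have hd1 : (1 : ℝ) ≤ d := by exact_mod_cast Nat.one_le_iff_ne_zero.mpr (Fin.pos μ).ne'
  set c : ℝ := U / (R : ℝ) ^ 2 with hc_def
  have hc0 : 0 ≤ c := by positivity
  have hcR2 : c * (R : ℝ) ^ 2 = U := by rw [hc_def]; field_simp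
  have hcR : c * (R : ℝ) = U / R := by rw [hc_def]; field_simp
  set k : ℝ := (d : ℝ) * c + B' with hk_def
  have hkc : c ≤ k := by rw [hk_def]; nlinarith
  have hk0 : 0 ≤ k := hc0.trans hkc
  -- the reflection about `x_μ = ½`
  set ρ : Site d → Site d := fun x => Function.update x μ (1 - x μ) with hρ_def
  have ρμ : ∀ x : Site d, ρ x μ = 1 - x μ := fun x => by simp [hρ_def]
  have ρne : ∀ (x : Site d) {i : Fin d}, i ≠ μ → ρ x i = x i := fun x i hi => by simp [hρ_def, hi]
  have ρρ : ∀ x : Site d, ρ (ρ x) = x := by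
    intro x; funext i
    by_cases hi : i = μ
    · subst hi; rw [ρμ, ρμ]; ring
    · rw [ρne _ hi, ρne _ hi]
  have heself : ∀ i : Fin d, e i i = (1 : ℤ) := fun i => by simp [e_apply]
  have heother : ∀ {i l : Fin d}, l ≠ i → e i l = (0 : ℤ) := fun {i l} h => by simp [e_apply, h]
  have ρ_add_ne : ∀ (x : Site d) {i : Fin d}, i ≠ μ → ρ (x + e i) = ρ x + e i := by
    intro x i hi; funext l
    by_cases hl : l = μ
    · rw [hl]; simp only [Pi.add_apply, ρμ, heother (Ne.symm hi)]; ring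
    · simp only [Pi.add_apply, ρne _ hl]
  have ρ_sub_ne : ∀ (x : Site d) {i : Fin d}, i ≠ μ → ρ (x - e i) = ρ x - e i := by
    intro x i hi; funext l
    by_cases hl : l = μ
    · rw [hl]; simp only [Pi.sub_apply, ρμ, heother (Ne.symm hi)]; ring
    · simp only [Pi.sub_apply, ρne _ hl]
  have ρ_add_μ : ∀ x : Site d, ρ (x + e μ) = ρ x - e μ := by
    intro x; funext l
    by_cases hl : l = μ
    · rw [hl]; simp only [Pi.add_apply, Pi.sub_apply, ρμ, heself]; ring
    · simp only [Pi.add_apply, Pi.sub_apply, ρne _ hl, heother hl]; ring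
  have ρ_sub_μ : ∀ x : Site d, ρ (x - e μ) = ρ x + e μ := by
    intro x
    have h := ρ_add_μ (x - e μ)
    rw [sub_add_cancel] at h
    rw [h, sub_add_cancel]
  have ρe : ρ (e μ) = 0 := by
    funext l
    by_cases hl : l = μ
    · rw [hl, ρμ, heself]; simp
    · rw [ρne _ hl, heother hl]; simp
  have ρcube : ∀ x : Site d, (∀ i, |x i| ≤ (R : ℤ)) → 1 ≤ x μ → ∀ i, |ρ x i| ≤ (R : ℤ) := by
    intro x hx hxμ i
    by_cases hi : i = μ
    · subst hi; rw [ρμ]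
      have := hx i; rw [abs_le] at this ⊢; constructor <;> omega
    · rw [ρne _ hi]; exact hx i
  -- the odd reflection `φ` and the barrier `ψ`
  set φ : Site d → ℝ := fun x => (u x - u (ρ x)) / 2 with hφ_def
  have φρ : ∀ x, φ (ρ x) = -φ x := fun x => by simp only [hφ_def, ρρ]; ring
  have φle : ∀ x : Site d, (∀ i, |x i| ≤ (R : ℤ)) → 1 ≤ x μ → φ x ≤ U := by
    intro x hx hxμ
    have h1 := hU x hx
    have h2 := hU (ρ x) (ρcube x hx hxμ)
    rw [abs_le] at h1 h2
    simp only [hφ_def]; linarith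
  set t : Site d → ℝ := fun x => ∑ i, ((x i : ℤ) : ℝ) ^ 2 with ht_def
  set ψ : Site d → ℝ := fun x => c * t x + k * R * ((x μ : ℤ) : ℝ) - k * ((x μ : ℤ) : ℝ) ^ 2 with hψ_def
  -- the lattice Laplacian of the barrier is the constant `−2B′`
  have lapψ : ∀ x : Site d, ∑ i, ((ψ (x + e i) - ψ x) - (ψ x - ψ (x - e i))) = -2 * B' := by
    intro x
    have hterm : ∀ i, (ψ (x + e i) - ψ x) - (ψ x - ψ (x - e i)) = 2 * c - (if i = μ then 2 * k else 0) := by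
      intro i
      have h1 : t (x + e i) = t x + 2 * ((x i : ℤ) : ℝ) + 1 := sum_sq_add_e x i
      have h2 : t (x - e i) = t x - 2 * ((x i : ℤ) : ℝ) + 1 := sum_sq_sub_e x i
      have h3 : (((x + e i) μ : ℤ) : ℝ) = ((x μ : ℤ) : ℝ) + if μ = i then 1 else 0 := by
        rw [Pi.add_apply, e_apply]; push_cast; split_ifs <;> simp
      have h4 : (((x - e i) μ : ℤ) : ℝ) = ((x μ : ℤ) : ℝ) - if μ = i then 1 else 0 := by
        rw [Pi.sub_apply, e_apply]; push_cast; split_ifs <;> simp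
      simp only [hψ_def]
      rw [h1, h2, h3, h4]
      by_cases hi : μ = i
      · rw [if_pos hi, if_pos hi.symm]; ring
      · rw [if_neg hi, if_neg (Ne.symm hi)]; ring
    simp only [hterm, Finset.sum_sub_distrib, Finset.sum_const, Finset.card_univ, Fintype.card_fin, nsmul_eq_mul,
      Finset.sum_ite_eq', Finset.mem_univ, if_true, hk_def]
    ring
  -- the barrier dominates `U` on the top layer and on the side faces, and is `≥ 0` with `ψ(p − e_μ) + ψ p ≥ 0` on the first layer
  have ψtop : ∀ x : Site d, x μ = R → U ≤ ψ x := by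
    intro x hx
    have h1 : ((R : ℤ) : ℝ) ^ 2 ≤ t x := by rw [← hx]; exact sq_le_sum_sq x μ
    have h2 : ψ x = c * t x + k * R * R - k * (R : ℝ) ^ 2 := by simp only [hψ_def, hx]; push_cast; ring
    rw [h2]
    have h3 : c * ((R : ℤ) : ℝ) ^ 2 ≤ c * t x := mul_le_mul_of_nonneg_left h1 hc0
    push_cast at h3
    nlinarith
  have ψside : ∀ x : Site d, (∃ i, i ≠ μ ∧ |x i| = (R : ℤ)) → 1 ≤ x μ → x μ ≤ R → U ≤ ψ x := by
    rintro x ⟨i, hi, hxi⟩ h1 h2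
    have hsq : ((x i : ℤ) : ℝ) ^ 2 = (R : ℝ) ^ 2 := by
      have : (x i : ℤ) ^ 2 = (R : ℤ) ^ 2 := by rw [← sq_abs, hxi]
      exact_mod_cast this
    have ht : (R : ℝ) ^ 2 + ((x μ : ℤ) : ℝ) ^ 2 ≤ t x := by rw [← hsq]; exact sq_add_sq_le_sum_sq x hi
    have hs1 : (1 : ℝ) ≤ ((x μ : ℤ) : ℝ) := by exact_mod_cast h1
    have hs2 : ((x μ : ℤ) : ℝ) ≤ R := by exact_mod_cast h2
    have h3 : c * ((R : ℝ) ^ 2 + ((x μ : ℤ) : ℝ) ^ 2) ≤ c * t x := mul_le_mul_of_nonneg_left ht hc0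
    have h4 : 0 ≤ ((x μ : ℤ) : ℝ) * (k * (R - ((x μ : ℤ) : ℝ))) := mul_nonneg (by linarith) (mul_nonneg hk0 (by linarith))
    have h5 : 0 ≤ c * ((x μ : ℤ) : ℝ) ^ 2 := by positivity
    simp only [hψ_def]
    nlinarith
  -- the finite half-cube `Ω` and its membership facts
  set box : Finset (Site d) := Fintype.piFinset fun _ : Fin d => Finset.Icc (-(R : ℤ)) (R : ℤ) with hbox_def
  have mem_box : ∀ x : Site d, x ∈ box ↔ ∀ i, |x i| ≤ (R : ℤ) := by
    intro x
    simp only [hbox_def, Fintype.mem_piFinset, Finset.mem_Icc, abs_le]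
  set Ω : Finset (Site d) := box.filter (fun x => 1 ≤ x μ) with hΩ_def
  have mem_Ω : ∀ x : Site d, x ∈ Ω ↔ (∀ i, |x i| ≤ (R : ℤ)) ∧ 1 ≤ x μ := by
    intro x; rw [hΩ_def, Finset.mem_filter, mem_box]
  have heμ : e μ ∈ Ω := by
    rw [mem_Ω]
    refine ⟨fun i => ?_, by simp [e_apply]⟩
    by_cases hi : i = μ
    · subst hi; simp [e_apply]; exact_mod_cast hR
    · simp [e_apply, hi]
  have hΩne : Ω.Nonempty := ⟨e μ, heμ⟩
  -- THE COMPARISON `φ ≤ ψ` ON `Ω`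
  have key : ∀ q ∈ Ω, φ q ≤ ψ q := by
    by_contra hcon
    push Not at hcon
    obtain ⟨q, hqΩ, hq⟩ := hcon
    obtain ⟨p, hpΩ, hpmax⟩ := Finset.exists_max_image Ω (fun x => φ x - ψ x) hΩne
    have hwp : 0 < φ p - ψ p := lt_of_lt_of_le (sub_pos.mpr hq) (hpmax q hqΩ)
    obtain ⟨hpcube, hpμ⟩ := (mem_Ω p).1 hpΩ
    have hpμR : p μ ≤ R := (abs_le.mp (hpcube μ)).2
    -- boundary layers are excluded
    by_cases htop : p μ = R
    · exact absurd (ψtop p htop) (by linarith [φle p hpcube hpμ])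
    by_cases hside : ∃ i, i ≠ μ ∧ |p i| = (R : ℤ)
    · exact absurd (ψside p hside hpμ hpμR) (by linarith [φle p hpcube hpμ])
    push Not at hside
    -- `p` is interior: `p_μ ≤ R − 1`, `|p_i| ≤ R − 1` for `i ≠ μ`
    have hpμ' : p μ + 1 ≤ R := by omega
    have hpi : ∀ i, i ≠ μ → |p i| + 1 ≤ (R : ℤ) := fun i hi => by
      have h1 := hpcube i; have h2 := hside i hi; omega
    -- its neighbours in `Ω`
    have hnb_add : ∀ i, i ≠ μ → p + e i ∈ Ω := by
      intro i hi; rw [mem_Ω]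
      refine ⟨fun l => ?_, by rw [Pi.add_apply, e_apply, if_neg (Ne.symm hi)]; omega⟩
      rw [Pi.add_apply, e_apply]
      by_cases hl : l = i
      · rw [if_pos hl]; subst hl
        have h1 := hpi l hi; have ha := le_abs_self (p l); have hb := neg_le_abs (p l)
        rw [abs_le]; constructor <;> omega
      · rw [if_neg hl, add_zero]; exact hpcube l
    have hnb_sub : ∀ i, i ≠ μ → p - e i ∈ Ω := by
      intro i hi; rw [mem_Ω]
      refine ⟨fun l => ?_, by rw [Pi.sub_apply, e_apply, if_neg (Ne.symm hi)]; omega⟩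
      rw [Pi.sub_apply, e_apply]
      by_cases hl : l = i
      · rw [if_pos hl]; subst hl
        have h1 := hpi l hi; have ha := le_abs_self (p l); have hb := neg_le_abs (p l)
        rw [abs_le]; constructor <;> omega
      · rw [if_neg hl, sub_zero]; exact hpcube l
    have hnb_up : p + e μ ∈ Ω := by
      rw [mem_Ω]
      refine ⟨fun l => ?_, by rw [Pi.add_apply, e_apply, if_pos rfl]; omega⟩
      rw [Pi.add_apply, e_apply]
      by_cases hl : l = μ
      · rw [if_pos hl]; subst hl; rw [abs_le]; constructor <;> omega
      · rw [if_neg hl, add_zero]; exact hpcube l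
    -- the Poisson inequality for `φ` at `p`: `Δφ(p) ≥ −B`
    have hρp_cube : ∀ i, |ρ p i| ≤ (R : ℤ) := ρcube p hpcube hpμ
    have hlapu := (abs_le.mp (hB p hpcube)).1
    have hlapuρ := (abs_le.mp (hB (ρ p) hρp_cube)).2
    have hlapφ : -B ≤ ∑ i, ((φ (p + e i) - φ p) - (φ p - φ (p - e i))) := by
      have hρsum : ∑ i, ((u (ρ (p + e i)) - u (ρ p)) - (u (ρ p) - u (ρ (p - e i))))
          = ∑ i, ((u (ρ p + e i) - u (ρ p)) - (u (ρ p) - u (ρ p - e i))) := by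
        refine Finset.sum_congr rfl fun i _ => ?_
        by_cases hi : i = μ
        · subst hi; rw [ρ_add_μ, ρ_sub_μ]; ring
        · rw [ρ_add_ne _ hi, ρ_sub_ne _ hi]
      have hφsum : ∑ i, ((φ (p + e i) - φ p) - (φ p - φ (p - e i)))
          = (∑ i, ((u (p + e i) - u p) - (u p - u (p - e i)))
              - ∑ i, ((u (ρ (p + e i)) - u (ρ p)) - (u (ρ p) - u (ρ (p - e i))))) / 2 := by
        simp only [hφ_def, Finset.sum_div, ← Finset.sum_sub_distrib]
        refine Finset.sum_congr rfl fun i _ => ?_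
        ring
      rw [hφsum, hρsum]
      linarith
    -- maximality over the neighbours in `Ω`
    have hmx : ∀ q ∈ Ω, φ q ≤ φ p - ψ p + ψ q := fun q hq => by linarith [hpmax q hq]
    by_cases hfirst : p μ = 1
    · -- first layer: the missing neighbour `p − e_μ` is the reflection of `p`
      have hρp : ρ p = p - e μ := by
        funext l
        by_cases hl : l = μ
        · rw [hl, ρμ, Pi.sub_apply, e_apply, if_pos rfl]; omega
        · rw [ρne _ hl, Pi.sub_apply, e_apply, if_neg hl, sub_zero]
      have hφdown : φ (p - e μ) = -φ p := by rw [← hρp, φρ]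
      -- `ψ(p − e_μ) + ψ(p) ≥ 0`
      have hψpair : 0 ≤ ψ (p - e μ) + ψ p := by
        have h1 : (1 : ℝ) ≤ t p := by
          have := sq_le_sum_sq p μ
          rw [hfirst] at this; simpa using this
        have h2 : ψ (p - e μ) + ψ p = 2 * c * t p - c + k * R - k := by
          have h3 : t (p - e μ) = t p - 2 * ((p μ : ℤ) : ℝ) + 1 := sum_sq_sub_e p μ
          have h4 : (((p - e μ) μ : ℤ) : ℝ) = 0 := by rw [Pi.sub_apply, e_apply, if_pos rfl, hfirst]; simp
          have h5 : ((p μ : ℤ) : ℝ) = 1 := by rw [hfirst]; simp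
          simp only [hψ_def]
          rw [h3, h4, h5]; ring
        rw [h2]; nlinarith
      -- termwise domination, strict in the `μ`-term
      have hterm : ∀ i, i ≠ μ → (φ (p + e i) - φ p) - (φ p - φ (p - e i)) ≤ (ψ (p + e i) - ψ p) - (ψ p - ψ (p - e i)) := by
        intro i hi
        have h1 := hmx _ (hnb_add i hi)
        have h2 := hmx _ (hnb_sub i hi)
        linarith
      have htermμ : (φ (p + e μ) - φ p) - (φ p - φ (p - e μ))
          < (ψ (p + e μ) - ψ p) - (ψ p - ψ (p - e μ)) - (ψ (p - e μ) + ψ p) := by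
        have h1 := hmx _ hnb_up
        rw [hφdown]; linarith
      have hlt : ∑ i, ((φ (p + e i) - φ p) - (φ p - φ (p - e i)))
          < ∑ i, ((ψ (p + e i) - ψ p) - (ψ p - ψ (p - e i))) - (ψ (p - e μ) + ψ p) := by
        rw [← Finset.add_sum_erase _ _ (Finset.mem_univ μ), ← Finset.add_sum_erase _ (fun i => (ψ (p + e i) - ψ p) - (ψ p - ψ (p - e i)))
          (Finset.mem_univ μ)]
        have hrest : ∑ i ∈ Finset.univ.erase μ, ((φ (p + e i) - φ p) - (φ p - φ (p - e i)))
            ≤ ∑ i ∈ Finset.univ.erase μ, ((ψ (p + e i) - ψ p) - (ψ p - ψ (p - e i))) :=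
          Finset.sum_le_sum fun i hi => hterm i (Finset.ne_of_mem_erase hi)
        linarith
      rw [lapψ p] at hlt
      linarith
    · -- deeper layers: all `2d` neighbours lie in `Ω`
      have hnb_down : p - e μ ∈ Ω := by
        rw [mem_Ω]
        refine ⟨fun l => ?_, by rw [Pi.sub_apply, e_apply, if_pos rfl]; omega⟩
        rw [Pi.sub_apply, e_apply]
        by_cases hl : l = μ
        · rw [if_pos hl]; subst hl; rw [abs_le]; constructor <;> omega
        · rw [if_neg hl, sub_zero]; exact hpcube l
      have hterm : ∀ i, (φ (p + e i) - φ p) - (φ p - φ (p - e i)) ≤ (ψ (p + e i) - ψ p) - (ψ p - ψ (p - e i)) := by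
        intro i
        by_cases hi : i = μ
        · subst hi
          have h1 := hmx _ hnb_up
          have h2 := hmx _ hnb_down
          linarith
        · have h1 := hmx _ (hnb_add i hi)
          have h2 := hmx _ (hnb_sub i hi)
          linarith
      have hle : ∑ i, ((φ (p + e i) - φ p) - (φ p - φ (p - e i))) ≤ ∑ i, ((ψ (p + e i) - ψ p) - (ψ p - ψ (p - e i))) :=
        Finset.sum_le_sum fun i _ => hterm i
      rw [lapψ p] at hle
      linarith
  -- evaluation at `e_μ`
  have hφe : φ (e μ) = (u (e μ) - u 0) / 2 := by simp only [hφ_def, ρe]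
  have hψe : ψ (e μ) ≤ (d : ℝ) * U / R + R * B' := by
    have h1 : ψ (e μ) = c + k * R - k := by
      have ht1 : t (e μ) = 1 := by
        simp only [ht_def, e_apply]
        rw [Finset.sum_eq_single μ (fun i _ hi => by rw [if_neg hi]; simp) (fun h => absurd (Finset.mem_univ μ) h)]
        simp
      simp only [hψ_def, ht1, e_apply]; push_cast; ring
    have h2 : k * R = (d : ℝ) * U / R + R * B' := by rw [hk_def, add_mul, mul_assoc, hcR]; ring
    rw [h1, ← h2]; linarith
  have := key (e μ) heμ
  rw [hφe] at this
  linarith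

end

end Summit.QuantumFields.BalabanUV.T4Continuum.NE3LatticeGradientBarrier
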